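/-
Origin: expansion seat `planner-pub-hodgecm-pv14-g6-0`, handover import Pv14g6.SchwartzMultiplierDeriv -> import HodgeCM.Automorphic.SchwartzMultiplierDeriv ; import Pv14g6.SchwartzFlowSmooth -> import HodgeCM.Automorphic.SchwartzFlowSmooth ; after SchwartzMultiplierDeriv (RUN 30 row 8) and t31 row 6 (SchwartzFlowSmooth) (`HOME/pub-hodgecm-pv14-g6/lean/Pv14g6/SchwartzMultiplierSmooth.lean`, md5 56e489c0, 117 lines);
landed by the gen-8 packager in gate run 31 as `HodgeCM/Automorphic/SchwartzMultiplierSmooth.lean` (import ^import Pv14g6\.SchwartzFlowSmooth[ \t]*$→import HodgeCM.Automorphic.SchwartzFlowSmooth ×1; import ^import Pv14g6\.SchwartzMultiplierDeriv[ \t]*$→import HodgeCM.Automorphic.SchwartzMultiplierDeriv ×1).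
-/
/-
Copyright: HodgeCM public adjudication package, seat pub-hodgecm-pv14-g6 (DAG-NODE PROVER #14, gen 6).
File #23 of this seat.  Kernel-checked, no new axioms.  Imports files #10 and #21 of this seat and
Mathlib only.
-/
import Summits.HodgeConjecture.HodgeCM.Automorphic.SchwartzMultiplierDeriv
import Summits.HodgeConjecture.HodgeCM.Automorphic.SchwartzFlowSmooth

/-!
# Temperate multiplier groups: every base point, and scalar `C^∞`

File #10 (`SchwartzMultiplierDeriv`) proves that for `g : V → ℝ` of temperate growth the unitary
multiplier group `E_s Φ = 𝐞(s g) Φ` on `𝓢(V, ℂ)` is differentiable AT `s = 0` in the Schwartz topology,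
with derivative the multiplication operator `2πi g`, and lists "higher derivatives in `s`" as not done.
This file supplies them:

* `smulLeftCLM_fourierChar_add_mul`: the group law `E_{s₀+s} = E_s ∘ E_{s₀}` on `𝓢(V, ℂ)`;
* `tendsto_smulLeftCLM_fourierChar_sub_div_at`: `s⁻¹ • (E_{s₀+s} Φ - E_{s₀} Φ) → (2πi g)(E_{s₀} Φ)`
  in `𝓢(V, ℂ)`, every `s₀`;
* `hasDerivAt_smulLeftCLM_fourierChar_at`: every scalar coefficient `s ↦ T (E_s Φ)`
  (`T : 𝓢(V, ℂ) →L[ℝ] G`) is differentiable at every `s₀`;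
* `contDiff_apply_smulLeftCLM_fourierChar`: it is `C^∞` on `ℝ`, with
  `iteratedDeriv k (s ↦ T (E_s Φ)) = s ↦ T ((2πi g ·)^[k] (E_s Φ))`
  (`iteratedDeriv_apply_smulLeftCLM_fourierChar`), by the induction engine of file #21.

Only published mathematics is used (Mathlib); nothing here refers to the objects under adjudication.
-/

noncomputable section

open scoped Real FourierTransform SchwartzMap Topology ContDiff
open Complex Filter

namespace HodgeCM
namespace SchwartzWeil

variable {V : Type*} [NormedAddCommGroup V] [NormedSpace ℝ V] {g : V → ℝ}
variable {G : Type*} [NormedAddCommGroup G] [NormedSpace ℝ G]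

/-- The group law of a multiplier group on `𝓢(V, ℂ)`: `𝐞((s₀ + s) g) Φ = 𝐞(s g) (𝐞(s₀ g) Φ)`. -/
theorem smulLeftCLM_fourierChar_add_mul (hg : g.HasTemperateGrowth) (Φ : 𝓢(V, ℂ)) (s₀ s : ℝ) :
    SchwartzMap.smulLeftCLM ℂ (fun x => (𝐞 ((s₀ + s) * g x) : ℂ)) Φ
      = SchwartzMap.smulLeftCLM ℂ (fun x => (𝐞 (s * g x) : ℂ))
          (SchwartzMap.smulLeftCLM ℂ (fun x => (𝐞 (s₀ * g x) : ℂ)) Φ) := by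
  have hfun : (fun x => (𝐞 ((s₀ + s) * g x) : ℂ))
      = (fun x => (𝐞 (s * g x) : ℂ)) * (fun x => (𝐞 (s₀ * g x) : ℂ)) := by
    funext x
    show (𝐞 ((s₀ + s) * g x) : ℂ) = 𝐞 (s * g x) * 𝐞 (s₀ * g x)
    rw [add_mul, AddChar.map_add_eq_mul, Circle.coe_mul]
    exact mul_comm _ _
  rw [SchwartzMap.smulLeftCLM_smulLeftCLM_apply (hasTemperateGrowth_fourierChar_mul_comp hg s)
    (hasTemperateGrowth_fourierChar_mul_comp hg s₀), hfun]

/-- **Multiplier groups are differentiable at every base point** in the Schwartz topology: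
`s⁻¹ • (𝐞((s₀+s) g) Φ - 𝐞(s₀ g) Φ) → (2πi g) (𝐞(s₀ g) Φ)`. -/
theorem tendsto_smulLeftCLM_fourierChar_sub_div_at (hg : g.HasTemperateGrowth) (Φ : 𝓢(V, ℂ)) (s₀ : ℝ) :
    Tendsto (fun s : ℝ => s⁻¹ • (SchwartzMap.smulLeftCLM ℂ (fun x => (𝐞 ((s₀ + s) * g x) : ℂ)) Φ
        - SchwartzMap.smulLeftCLM ℂ (fun x => (𝐞 (s₀ * g x) : ℂ)) Φ)) (𝓝[≠] 0)
      (𝓝 (SchwartzMap.smulLeftCLM ℂ (fun x => 2 * π * I * (g x : ℂ))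
        (SchwartzMap.smulLeftCLM ℂ (fun x => (𝐞 (s₀ * g x) : ℂ)) Φ))) := by
  simp only [smulLeftCLM_fourierChar_add_mul hg Φ s₀]
  exact tendsto_smulLeftCLM_fourierChar_sub_div hg _

/-- Every scalar coefficient `s ↦ T (𝐞(s g) Φ)` is differentiable at every `s₀`, with derivative
`T ((2πi g) (𝐞(s₀ g) Φ))`. -/
theorem hasDerivAt_smulLeftCLM_fourierChar_at (hg : g.HasTemperateGrowth) (Φ : 𝓢(V, ℂ))
    (T : 𝓢(V, ℂ) →L[ℝ] G) (s₀ : ℝ) :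
    HasDerivAt (fun s : ℝ => T (SchwartzMap.smulLeftCLM ℂ (fun x => (𝐞 (s * g x) : ℂ)) Φ))
      (T (SchwartzMap.smulLeftCLM ℂ (fun x => 2 * π * I * (g x : ℂ))
        (SchwartzMap.smulLeftCLM ℂ (fun x => (𝐞 (s₀ * g x) : ℂ)) Φ))) s₀ := by
  rw [hasDerivAt_iff_tendsto_slope_zero]
  have h := (T.continuous.tendsto _).comp (tendsto_smulLeftCLM_fourierChar_sub_div_at hg Φ s₀)
  refine h.congr fun s => ?_
  simp only [Function.comp_apply, map_smul, map_sub]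

/-- **Scalar smoothness of multiplier groups**: `s ↦ T (𝐞(s g) Φ)` is `C^∞` on `ℝ`. -/
theorem contDiff_apply_smulLeftCLM_fourierChar (hg : g.HasTemperateGrowth) (Φ : 𝓢(V, ℂ))
    (T : 𝓢(V, ℂ) →L[ℝ] G) :
    ContDiff ℝ ∞ (fun s : ℝ => T (SchwartzMap.smulLeftCLM ℂ (fun x => (𝐞 (s * g x) : ℂ)) Φ)) :=
  contDiff_infty_apply_of_hasDerivAt_comp
    (γ := fun s : ℝ => SchwartzMap.smulLeftCLM ℂ (fun x => (𝐞 (s * g x) : ℂ)) Φ)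
    (N := (SchwartzMap.smulLeftCLM ℂ (fun x => 2 * π * I * (g x : ℂ))).restrictScalars ℝ)
    (fun T s => hasDerivAt_smulLeftCLM_fourierChar_at hg Φ T s) T

/-- The iterated derivatives: `(d/ds)^k T (𝐞(s g) Φ) = T ((2πi g ·)^[k] (𝐞(s g) Φ))`. -/
theorem iteratedDeriv_apply_smulLeftCLM_fourierChar (hg : g.HasTemperateGrowth) (Φ : 𝓢(V, ℂ))
    (T : 𝓢(V, ℂ) →L[ℝ] G) (k : ℕ) :
    iteratedDeriv k (fun s : ℝ => T (SchwartzMap.smulLeftCLM ℂ (fun x => (𝐞 (s * g x) : ℂ)) Φ))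
      = fun s => T ((fun Ψ => SchwartzMap.smulLeftCLM ℂ (fun x => 2 * π * I * (g x : ℂ)) Ψ)^[k]
          (SchwartzMap.smulLeftCLM ℂ (fun x => (𝐞 (s * g x) : ℂ)) Φ)) :=
  iteratedDeriv_apply_of_hasDerivAt_comp
    (γ := fun s : ℝ => SchwartzMap.smulLeftCLM ℂ (fun x => (𝐞 (s * g x) : ℂ)) Φ)
    (N := (SchwartzMap.smulLeftCLM ℂ (fun x => 2 * π * I * (g x : ℂ))).restrictScalars ℝ)
    (fun T s => hasDerivAt_smulLeftCLM_fourierChar_at hg Φ T s) k T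

/-- The iterate of the multiplication operator is multiplication by the power:
`(2πi g ·)^[k] Ψ = ((2πi g)^k) Ψ`. -/
theorem smulLeftCLM_iterate_eq_pow (hg : g.HasTemperateGrowth) (Ψ : 𝓢(V, ℂ)) (k : ℕ) :
    (fun Ψ => SchwartzMap.smulLeftCLM ℂ (fun x => 2 * π * I * (g x : ℂ)) Ψ)^[k] Ψ
      = SchwartzMap.smulLeftCLM ℂ (fun x => (2 * π * I * (g x : ℂ)) ^ k) Ψ := by
  induction k with
  | zero =>
    rw [Function.iterate_zero_apply]
    simp only [pow_zero]
    rw [SchwartzMap.smulLeftCLM_const, one_smul, ContinuousLinearMap.id_apply]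
  | succ k ih =>
    have hk : (fun x => (2 * π * I * (g x : ℂ)) ^ k).HasTemperateGrowth :=
      (hasTemperateGrowth_two_pi_I_mul hg).pow k
    have hfun : (fun x => (2 * π * I * (g x : ℂ)) ^ (k + 1))
        = (fun x => 2 * π * I * (g x : ℂ)) * (fun x => (2 * π * I * (g x : ℂ)) ^ k) := by
      funext x
      simp only [Pi.mul_apply, pow_succ, mul_comm]
    rw [Function.iterate_succ_apply', ih,
      SchwartzMap.smulLeftCLM_smulLeftCLM_apply (hasTemperateGrowth_two_pi_I_mul hg) hk, hfun]

end SchwartzWeil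
end HodgeCM
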